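import Summits.AnomalousDissipation.AnomalousDissipation.Theorems.SolenoidalFractalHomogenisationLagrangianStepVmodSSRegimesD
import Summits.AnomalousDissipation.AnomalousDissipation.Theorems.SolenoidalFractalHomogenisationLagrangianStepVmodIterFast
import HarnessLib

/-!
# K1L_D (stmt-AnomalousDissipation-27980): (V_mod) flat stage, block (fs) — THE GRID-ITERATION ROW (tool T-I) FOR A FAST CLASS DATUM in the
# allowance currency of `BlockBound` (row «coarse, ν < ν_c, τ ≥ t₁» of the certifier's table, §4 (fs) «(V) on coarse classes»)
(helper; `--supports 27980 --as helper`; prover ad-k1loc-p3 g10; the fast-datum twin of p1 g15's `VmodGen.defect_le_alw_of_scale_iter`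
(`…VmodSSRegimesD`) on top of `VmodGen.norm_fc_leak_le_iterate_fast` (`…VmodIterFast`, p717831); p1's scalar tools `exp_neg_half_lt`,
`window_factor_le`, `iter_charge` are imported, the proof body is p1's verbatim with `‖v‖` in place of `‖𝓕v(ℓ)‖`.)

`leak_le_alw_of_scale_iter_fast`: grid start `s = j₀·P` (`P = M·W.period/ν`), a coarse slow label `ℓ` within scale (`u = 8π²·loT·|ℓ|²·P ≤ 1`,
`‖ℓ‖⌈K/ν⌉ ≤ n`, `ℓ ∈ freqBall Lb`, `2Lb < n`), a long window (`8π²·loT·|ℓ|²·(t−s) ≥ 2`), the smallness `ρ ≤ 3/4` of the one-step constants,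
and a weakly divergence-free FAST member `v` of the class pair of `ℓ` (`𝓕v` supported on `(±ℓ + nℤ³)`, `𝓕v(±ℓ) = 0`):

  `‖𝓕(U s t v)(ℓ)‖ ≤ (C₁·(C₁·(ν^e + (⌈K/ν⌉₊/n)^e) + (min 1 (P/(t−s)))^e)) · dW lo Λ c ν n (t−s) ℓ · ‖v‖`

for every `e ≤ min(σ/2, 1/2)` and `C₁` above the two explicit thresholds of part D.  Since `dW ≤ √dW ≤ 1` this is the `hleak`/`hεd` input of
`VmodFlat.abs_inner_sub_le_sqrt_of_fast_modewise` with `ε_ℓ = alw·√(dW ℓ)`, `η = alw`.  `sorry`-free; NOT a proof of (fs), of the stub, of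
K1L_D or of AD; rung F-D1.A0.
-/

set_option linter.dupNamespace false

noncomputable section

namespace Summit.AnomalousDissipation.AnomalousDissipation.Theorems.SolenoidalFractalHomogenisation.LagrangianStep.VmodGen

open Set MeasureTheory Complex UnitAddTorus
open scoped InnerProductSpace ENNReal
open Literature.Analysis Literature.Analysis.FunctionSpaces Literature.Analysis.FunctionSpaces.Torus
open Literature.Analysis.FluidPDE Literature.Analysis.FluidPDE.Torus Literature.Analysis.FluidPDE.LatticeShear
open Summit.AnomalousDissipation.AnomalousDissipation.Theorems.SolenoidalFractalHomogenisation.LagrangianStep.Sideband (slotAmp)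
open Summit.AnomalousDissipation.AnomalousDissipation.Theorems.SolenoidalFractalHomogenisation.LagrangianStep.VmodFlat (fc fc_sub loT dW)

section Clause

variable {k : ℕ} {W : LatticeWord k} {M : ℝ} {hM : 0 < M} {c : ℝ}
  {Φ : ℝ → Visc4 (Fin 3) → Visc4 (Fin 3)} {lo hi Λ β σ C ν₀ K : ℝ}
  {ν : ℝ} {n : ℕ} {𝔸 : Visc4 (Fin 3)} {Tw : ℝ} {U T : ℝ → ℝ → (V2 →L[ℝ] V2)}

set_option maxHeartbeats 8000000 in
/-- **T-I ROW FOR A FAST CLASS DATUM, in the final currency** (block (fs), coarse classes within scale `u = R·P ≤ 1`, long windows `Rτ ≥ 2`,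
grid start `s = j₀P`): the fast-datum twin of `defect_le_alw_of_scale_iter` (p1 g15, `…VmodSSRegimesD`) — same hypotheses with the pair datum
replaced by a weakly divergence-free FAST member `v` of the class pair of `ℓ`, `norm_fc_leak_le_iterate_fast` (`…VmodIterFast`) in place of
`defect_le_iterate`, the scalar bookkeeping (`window_factor_le`, `iter_charge`) verbatim:
`‖𝓕(U s t v)(ℓ)‖ ≤ (C₁(C₁(ν^e + (⌈K/ν⌉₊/n)^e) + (min 1 (P/(t−s)))^e)) · dW(t−s, ℓ) · ‖v‖`. -/
theorem leak_le_alw_of_scale_iter_fast (hV : SlowVectorClauseF W M hM c Φ lo hi Λ β σ C ν₀ K)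
    (hlo : 0 < lo) (hhi : 0 ≤ hi) (hΛ : 1 ≤ Λ) (hc : 0 < c) (hC : 0 ≤ C) (hσ : 0 < σ) (hK : 0 ≤ K)
    (hν : ν ∈ Set.Ioo 0 ν₀) (hν1 : ν ≤ 1) (hn : 1 ≤ n) (hodd : OddSmall 𝔸 (ν * β))
    (hwin : ∃ lam ∈ Set.Icc (1:ℝ) Λ, NearIso 𝔸 (ν * (lo / lam)) (ν * (hi * lam)))
    (hΦw : ∃ lam ∈ Set.Icc (1:ℝ) Λ, NearIso (Φ ν ((1 / ν) • 𝔸)) (lo / lam) (hi * lam))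
    (hU : IsPropagator Tw (cellField W M hM ν hν.1 n) ((1 / (n:ℝ) ^ 2) • 𝔸) U)
    (hT : IsPropagator Tw (fun (_ : ℝ) (_ : UnitAddTorus (Fin 3)) => (0 : EuclideanSpace ℝ (Fin 3)))
      ((1 / (n:ℝ) ^ 2) • (𝔸 + (c / ν) • Φ ν ((1 / ν) • 𝔸))) T)
    {s t : ℝ} (j₀ : ℕ) (hs₀ : s = j₀ * (M * W.period / ν)) (hst : s < t) (htT : t ≤ Tw)
    {Lb : ℕ} (hLb : 2 * Lb < n) {ℓ : Fin 3 → ℤ} (hℓ0 : ℓ ≠ 0) (hℓL : ℓ ∈ Torus.freqBall (d := Fin 3) Lb)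
    (hscale : ‖Torus.latticeVec ℓ‖ * (⌈K / ν⌉₊ : ℝ) ≤ n)
    (v : V2) (hv : v ∈ divFreeL2 (Fin 3))
    (hvcl : ∀ k', fc v k' ≠ 0 → (∀ i, (n : ℤ) ∣ k' i - ℓ i) ∨ (∀ i, (n : ℤ) ∣ k' i + ℓ i))
    (hv1 : fc v ℓ = 0) (hv2 : fc v (-ℓ) = 0)
    {C₁ e : ℝ} (hC₁0 : 0 ≤ C₁) (hC₁a : 2 * 265 * (2 * Real.sqrt 2) * C ^ 2 ≤ C₁ * C₁)
    (hC₁b : 4 * 265 * (2 * Real.sqrt 2 * C ^ 2 * ((K + 1) ^ 2 / (8 * Real.pi ^ 2 * (lo / Λ) * (M * W.period) * c)) ^ (σ / 2)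
        + 2 * Real.sqrt 2 * C * (hi * Λ ^ 2 / lo)
        + 12 * k * Real.exp (9 * (k : ℝ) ^ 2 / (2 * Real.pi ^ 4 * (lo / Λ) ^ 2 * c))
            / (Real.pi ^ 2 * (lo / Λ) * Real.sqrt (8 * Real.pi ^ 2 * (lo / Λ) * (M * W.period) * c))) ≤ C₁)
    (heσ : e ≤ σ / 2) (he12 : e ≤ 1 / 2)
    (hρ : Real.exp (-(1 / 2 : ℝ))
        + 2 * Real.sqrt 2 * (C * (C * (ν ^ σ + (‖Torus.latticeVec ℓ‖ * (⌈K / ν⌉₊ : ℝ) / n) ^ σ)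
            + (8 * Real.pi ^ 2 * ‖Torus.latticeVec ℓ‖ ^ 2 * (hi * Λ) * (ν + c / ν) / (n:ℝ) ^ 2) * (M * W.period / ν)))
        + (12 * k * (Real.sqrt (freqNormSq ℓ) / n) / (Real.pi ^ 2 * (ν * (lo / Λ))))
            * Real.exp (9 * (k : ℝ) ^ 2 / (2 * Real.pi ^ 4 * (lo / Λ) ^ 2 * c))
        + 3 * (8 * (Real.sqrt (freqNormSq ℓ) / n) * (∑ j, ‖slotAmp W j‖) / (Real.pi * (ν * (lo / Λ))))
        + Real.exp (-(Real.pi ^ 2 * (ν * (lo / Λ)) / 2 * (1 / (8 * Real.pi ^ 2 * loT lo Λ c ν n * Torus.freqNormSq ℓ))))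
        ≤ 3 / 4)
    (hRP : 8 * Real.pi ^ 2 * loT lo Λ c ν n * Torus.freqNormSq ℓ * (M * W.period / ν) ≤ 1)
    (hRτ : 2 ≤ 8 * Real.pi ^ 2 * loT lo Λ c ν n * Torus.freqNormSq ℓ * (t - s)) :
    ‖fc (U s t v) ℓ‖
      ≤ (C₁ * (C₁ * (ν ^ e + ((⌈K / ν⌉₊ : ℝ) / n) ^ e) + (min 1 ((M * W.period / ν) / (t - s))) ^ e))
        * dW lo Λ c ν n (t - s) ℓ * ‖v‖ := by
  classical
  -- ### scalars
  have hτ0 : 0 < t - s := by linarith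
  have hsT : s < Tw := lt_of_lt_of_le hst htT
  have hn0 : (0:ℝ) < n := by exact_mod_cast (show 0 < n from hn)
  have hΛ0 : 0 < Λ := lt_of_lt_of_le one_pos hΛ
  have hloΛ : 0 < lo / Λ := div_pos hlo hΛ0
  have hloA : 0 < ν * (lo / Λ) := mul_pos hν.1 hloΛ
  have hWp := PermissibleCarrier.period_pos W
  have hMW : 0 < M * W.period := mul_pos hM hWp
  have hL0 : 0 < ‖Torus.latticeVec ℓ‖ := by
    refine norm_pos_iff.2 fun h => hℓ0 ?_
    funext i
    have hi := congrArg (fun w : EuclideanSpace ℝ (Fin 3) => w i) h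
    simpa [Torus.latticeVec_apply] using hi
  set q : ℝ := Torus.freqNormSq ℓ with hq
  have hq0 : 0 < q := by rw [hq, ← norm_latticeVec_sq_eq]; positivity
  have hνne : ν ≠ 0 := hν.1.ne'
  have hτne : t - s ≠ 0 := hτ0.ne'
  set P : ℝ := M * W.period / ν with hP
  have hP0 : 0 < P := div_pos hMW hν.1
  have hPne : P ≠ 0 := hP0.ne'
  set R : ℝ := 8 * Real.pi ^ 2 * loT lo Λ c ν n * q with hR
  have hR0 : 0 < R := by
    by_contra h; push Not at h
    have := mul_nonpos_of_nonpos_of_nonneg h hτ0.le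
    linarith
  have hRne : R ≠ 0 := hR0.ne'
  set u : ℝ := R * P with hu
  have hu0 : 0 < u := mul_pos hR0 hP0
  have hune : u ≠ 0 := hu0.ne'
  have hu1 : u ≤ 1 := hRP
  set m₁ : ℕ := ⌈1 / u⌉₊ with hm₁
  have hm₁pos : 0 < m₁ := Nat.ceil_pos.2 (by positivity)
  have hm₁1 : 1 ≤ m₁ := hm₁pos
  have hm₁r : (0:ℝ) < m₁ := by exact_mod_cast hm₁pos
  have hm₁u : 1 / u ≤ (m₁ : ℝ) := Nat.le_ceil _
  have hm₁2 : (m₁ : ℝ) ≤ 2 / u := by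
    have h1 := (Nat.ceil_lt_add_one (by positivity : (0:ℝ) ≤ 1 / u)).le
    have h2 : (1:ℝ) ≤ 1 / u := by rw [le_div_iff₀ hu0]; linarith
    calc (m₁ : ℝ) ≤ 1 / u + 1 := h1
      _ ≤ 2 / u := by rw [div_add_one hu0.ne', div_le_div_iff_of_pos_right hu0]; linarith
  set t₁ : ℝ := m₁ * P with ht₁
  have ht₁0 : 0 < t₁ := mul_pos hm₁r hP0
  have hRt₁ : 1 ≤ R * t₁ := by
    have := mul_le_mul_of_nonneg_left hm₁u hu0.le
    calc (1:ℝ) = u * (1 / u) := by field_simp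
      _ ≤ u * m₁ := this
      _ = R * t₁ := by rw [ht₁, hu]; ring
  have ht₁lo : 1 / R ≤ t₁ := by rw [div_le_iff₀ hR0]; linarith
  have ht₁hi : t₁ ≤ 2 / R := by
    have := mul_le_mul_of_nonneg_right hm₁2 hP0.le
    calc t₁ = m₁ * P := ht₁
      _ ≤ 2 / u * P := this
      _ = 2 / R := by rw [hu]; field_simp
  have ht₁τ : t₁ ≤ t - s := ht₁hi.trans (by rw [div_le_iff₀ hR0]; linarith)
  -- ### the one-step constants and their envelopes
  set g : ℝ := ‖Torus.latticeVec ℓ‖ * (⌈K / ν⌉₊ : ℝ) / n with hg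
  set ξ : ℝ := 8 * Real.pi ^ 2 * ‖Torus.latticeVec ℓ‖ ^ 2 * (hi * Λ) * (ν + c / ν) / (n:ℝ) ^ 2 with hξ
  set r₀ : ℝ := hi * Λ ^ 2 / lo with hr₀
  set κ₀ : ℝ := (K + 1) ^ 2 / (8 * Real.pi ^ 2 * (lo / Λ) * (M * W.period) * c) with hκ₀
  set D₀ : ℝ := 8 * Real.pi ^ 2 * (lo / Λ) * (M * W.period) * c with hD₀
  set E₁ : ℝ := 9 * (k : ℝ) ^ 2 / (2 * Real.pi ^ 4 * (lo / Λ) ^ 2 * c) with hE₁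
  have hg0 : 0 ≤ g := by rw [hg]; positivity
  have hr₀0 : 0 ≤ r₀ := by rw [hr₀]; positivity
  have hκ₀0 : 0 ≤ κ₀ := by rw [hκ₀]; positivity
  have hD₀0 : 0 < D₀ := by rw [hD₀]; positivity
  have hξR : ξ = r₀ * R := by rw [hξ, hr₀, hR, hq, norm_latticeVec_sq_eq]; unfold loT; field_simp
  set θ : ℝ := Real.exp (-(4 * Real.pi ^ 2 * loT lo Λ c ν n * q * (m₁ * P))) with hθ
  set cV : ℝ := 2 * Real.sqrt 2 * (C * (C * (ν ^ σ + g ^ σ) + ξ * P)) with hcV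
  set cL : ℝ := (12 * k * (Real.sqrt q / n) / (Real.pi ^ 2 * (ν * (lo / Λ)))) *
      Real.exp (18 * (k : ℝ) ^ 2 * (q / (n : ℝ) ^ 2) * (m₁ * P) / (Real.pi ^ 2 * (ν * (lo / Λ)))) with hcL
  set cLs : ℝ := (12 * k * (Real.sqrt q / n) / (Real.pi ^ 2 * (ν * (lo / Λ)))) * Real.exp E₁ with hcLs
  set cS : ℝ := 8 * (Real.sqrt q / n) * (∑ j, ‖slotAmp W j‖) / (Real.pi * (ν * (lo / Λ))) with hcS
  set κ : ℝ := Real.exp (-(Real.pi ^ 2 * (ν * (lo / Λ)) / 2 * (m₁ * P))) with hκ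
  set κs : ℝ := Real.exp (-(Real.pi ^ 2 * (ν * (lo / Λ)) / 2 * (1 / R))) with hκs
  have hθ0 : 0 ≤ θ := (Real.exp_pos _).le
  have hξ0 : 0 ≤ ξ := by rw [hξR]; exact mul_nonneg hr₀0 hR0.le
  have hcV0 : 0 ≤ cV := by
    rw [hcV]
    exact mul_nonneg (by positivity) (mul_nonneg hC (add_nonneg (mul_nonneg hC (add_nonneg (Real.rpow_nonneg hν.1.le σ)
      (Real.rpow_nonneg hg0 σ))) (mul_nonneg hξ0 hP0.le)))
  have hcL0 : 0 ≤ cL := by rw [hcL]; positivity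
  have hcS0 : 0 ≤ cS := by rw [hcS]; positivity
  have hκ0' : 0 ≤ κ := (Real.exp_pos _).le
  -- `θ ≤ e^{-1/2}`
  have hθs : θ ≤ Real.exp (-(1 / 2 : ℝ)) := by
    rw [hθ]; refine Real.exp_le_exp.2 ?_
    have : 4 * Real.pi ^ 2 * loT lo Λ c ν n * q * (m₁ * P) = R * t₁ / 2 := by rw [hR, ht₁]; ring
    rw [this]; linarith
  -- `cL ≤ cL^*`
  have hcLs_le : cL ≤ cLs := by
    rw [hcL, hcLs]
    refine mul_le_mul_of_nonneg_left (Real.exp_le_exp.2 ?_) (by positivity)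
    -- the exponent: `18k²(q/n²)t₁/(π²loA) ≤ 18k²(q/n²)(2/R)/(π²loA) = 9k²/(2π⁴(lo/Λ)²(ν²+c)) ≤ E₁`
    have h1 : 18 * (k : ℝ) ^ 2 * (q / (n : ℝ) ^ 2) * (m₁ * P) / (Real.pi ^ 2 * (ν * (lo / Λ)))
        ≤ 18 * (k : ℝ) ^ 2 * (q / (n : ℝ) ^ 2) * (2 / R) / (Real.pi ^ 2 * (ν * (lo / Λ))) := by
      refine div_le_div_of_nonneg_right (mul_le_mul_of_nonneg_left ?_ (by positivity)) (by positivity)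
      rw [← ht₁]; exact ht₁hi
    refine h1.trans ?_
    have e2 : 18 * (k : ℝ) ^ 2 * (q / (n : ℝ) ^ 2) * (2 / R) / (Real.pi ^ 2 * (ν * (lo / Λ)))
        = 9 * (k : ℝ) ^ 2 / (2 * Real.pi ^ 4 * (lo / Λ) ^ 2 * (ν ^ 2 + c)) := by
      rw [hR]; unfold loT
      have hνc : ν ^ 2 + c ≠ 0 := by have := hν.1; positivity
      field_simp
      ring
    rw [e2, hE₁]
    refine div_le_div_of_nonneg_left (by positivity) (by positivity) ?_
    refine mul_le_mul_of_nonneg_left ?_ (by positivity)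
    nlinarith [hν.1]
  -- `κ ≤ κ^*`
  have hκs_le : κ ≤ κs := by
    rw [hκ, hκs]; refine Real.exp_le_exp.2 (neg_le_neg (mul_le_mul_of_nonneg_left ?_ (by positivity)))
    rw [← ht₁]; exact ht₁lo
  -- `ρ ≤ 3/4`
  have hρ34 : θ + cV + cL + 3 * cS + κ ≤ 3 / 4 := by
    have : Real.exp (-(1 / 2 : ℝ)) + cV + cLs + 3 * cS + κs ≤ 3 / 4 := hρ
    linarith
  have hρ0 : 0 ≤ θ + cV + cL + 3 * cS + κ := by positivity
  have hρ1 : θ + cV + cL + 3 * cS + κ ≤ 1 := by linarith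
  -- ### the grid iteration
  have hiter := norm_fc_leak_le_iterate_fast hV hlo hhi hΛ hc.le hC hν hn hodd hwin hΦw hU hT hsT j₀ hs₀ m₁ hm₁1 hLb hℓ0 hℓL hscale v hv
    hvcl hv1 hv2 hθ hcV hcL hcS hκ hρ1
  set j : ℕ := ⌊(t - s) / t₁⌋₊ with hj
  have hjle : (j : ℝ) ≤ (t - s) / t₁ := Nat.floor_le (by positivity)
  have hjlt : (t - s) / t₁ < j + 1 := Nat.lt_floor_add_one _
  have hj1 : 1 ≤ j := Nat.le_floor (by rw [Nat.cast_one, le_div_iff₀ ht₁0, one_mul]; exact ht₁τ)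
  have hjr1 : (1:ℝ) ≤ j := by exact_mod_cast hj1
  have hlow : s + j * (m₁ * (M * W.period / ν)) ≤ t := by
    rw [← hP, ← ht₁]; have := (le_div_iff₀ ht₁0).1 hjle; linarith
  have hupp : t ≤ s + (j + 1) * (m₁ * (M * W.period / ν)) := by
    rw [← hP, ← ht₁]; have := (div_lt_iff₀ ht₁0).1 hjlt; linarith
  have hmain := hiter j t hlow hupp htT
  -- ### the window factor
  set ρ : ℝ := θ + cV + cL + 3 * cS + κ with hρdef
  have hWf : ((j : ℝ) + 1) ^ 2 * ρ ^ (j - 1) ≤ 265 := window_factor_le hρ0 hρ34 hj1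
  have hpow0 : 0 ≤ ρ ^ (j - 1) := pow_nonneg hρ0 _
  have hW1 : ((j : ℝ) + 1) * ρ ^ (j - 1) ≤ 265 := by nlinarith
  set y : ℝ := P / (t - s) with hy
  have hy0 : 0 < y := div_pos hP0 hτ0
  have hW2 : ((j : ℝ) + 1) * ρ ^ (j - 1) ≤ 265 * (m₁ * y) := by
    -- `1/(j+1) ≤ t₁/τ = m₁ y`
    have h1 : t - s ≤ (j + 1) * t₁ := by have := (div_lt_iff₀ ht₁0).1 hjlt; linarith
    have h2 : (m₁ : ℝ) * y = t₁ / (t - s) := by rw [hy, ht₁]; field_simp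
    rw [h2, mul_div_assoc', le_div_iff₀ hτ0]
    calc ((j : ℝ) + 1) * ρ ^ (j - 1) * (t - s) ≤ ((j : ℝ) + 1) * ρ ^ (j - 1) * ((j + 1) * t₁) :=
          mul_le_mul_of_nonneg_left h1 (by positivity)
      _ = (((j : ℝ) + 1) ^ 2 * ρ ^ (j - 1)) * t₁ := by ring
      _ ≤ 265 * t₁ := mul_le_mul_of_nonneg_right hWf ht₁0.le
  -- ### splitting `cV = cVν + cVr` and charging
  have hcVsplit : cV = 2 * Real.sqrt 2 * C ^ 2 * ν ^ σ + (2 * Real.sqrt 2 * C ^ 2 * g ^ σ + 2 * Real.sqrt 2 * C * r₀ * u) := by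
    rw [hcV, hξR, hu]; ring
  have hcVν0 : 0 ≤ 2 * Real.sqrt 2 * C ^ 2 * ν ^ σ := by have := Real.rpow_nonneg hν.1.le σ; positivity
  have hcVr0 : 0 ≤ 2 * Real.sqrt 2 * C ^ 2 * g ^ σ + 2 * Real.sqrt 2 * C * r₀ * u := by
    have := Real.rpow_nonneg hg0 σ; positivity
  -- inputs of `iter_charge`
  have hyu : 2 * y ≤ u := by
    have e1 : u = R * (t - s) * y := by rw [hu, hy]; field_simp
    rw [e1]; nlinarith [mul_nonneg (sub_nonneg.2 hRτ) hy0.le]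
  have hg2 : g ^ 2 ≤ κ₀ * u := by rw [hg, hκ₀, hu, hR, hq, hP]; exact g_sq_le hloΛ hc hMW hν.1 hν1 hK hn ℓ
  set cLp : ℝ := 12 * k * Real.exp E₁ / (Real.pi ^ 2 * (lo / Λ) * Real.sqrt D₀) with hcLp
  have hcLp0 : 0 ≤ cLp := by rw [hcLp]; positivity
  have hcL_le : cL ≤ cLp * Real.sqrt u := by
    refine hcLs_le.trans ?_
    -- `√q/(nν) ≤ √u/√D₀`
    have hsq : q / ((n:ℝ) ^ 2 * ν ^ 2) ≤ u / D₀ := by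
      rw [le_div_iff₀ hD₀0]
      have h := RP_ge (c := c) hloΛ.le hMW.le hν.1 hn ℓ
      rw [← hq] at h
      calc q / ((n:ℝ) ^ 2 * ν ^ 2) * D₀ = 8 * Real.pi ^ 2 * (lo / Λ) * (M * W.period) * c * (q / ((n:ℝ) ^ 2 * ν ^ 2)) := by
            rw [hD₀]; ring
        _ ≤ u := h
    have hsq2 : Real.sqrt q / (n * ν) ≤ Real.sqrt u / Real.sqrt D₀ := by
      have hnν : 0 < (n:ℝ) * ν := mul_pos hn0 hν.1
      have eL : Real.sqrt q / (n * ν) = Real.sqrt (q / ((n:ℝ) * ν) ^ 2) := by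
        rw [Real.sqrt_div hq0.le, Real.sqrt_sq hnν.le]
      have eR : Real.sqrt u / Real.sqrt D₀ = Real.sqrt (u / D₀) := by rw [Real.sqrt_div hu0.le]
      rw [eL, eR]
      refine Real.sqrt_le_sqrt ?_
      rw [show ((n:ℝ) * ν) ^ 2 = (n:ℝ) ^ 2 * ν ^ 2 by ring]
      exact hsq
    have e1 : cLs = (12 * k * Real.exp E₁ / (Real.pi ^ 2 * (lo / Λ))) * (Real.sqrt q / (n * ν)) := by
      rw [hcLs]; field_simp
    have e2 : cLp * Real.sqrt u = (12 * k * Real.exp E₁ / (Real.pi ^ 2 * (lo / Λ))) * (Real.sqrt u / Real.sqrt D₀) := by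
      rw [hcLp]; field_simp
    rw [e1, e2]
    exact mul_le_mul_of_nonneg_left hsq2 (by positivity)
  have hcharge := iter_charge (σ := σ) (e := e) hC hσ.le heσ he12 hg0 hu0 hu1 hy0 hyu hm₁2 hr₀0 hκ₀0 hg2 hcL0 hcLp0 hcL_le
  -- ### assembling
  have hv0 := norm_nonneg v
  have hνσ : ν ^ σ ≤ ν ^ e := Real.rpow_le_rpow_of_exponent_ge hν.1 hν1 (heσ.trans (by linarith))
  have hνe0 : 0 ≤ ν ^ e := Real.rpow_nonneg hν.1.le e
  have hye0 : 0 ≤ y ^ e := Real.rpow_nonneg hy0.le e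
  set Kx : ℝ := 2 * Real.sqrt 2 * C ^ 2 * κ₀ ^ (σ / 2) + 2 * Real.sqrt 2 * C * r₀ + cLp with hKx
  have hKx0 : 0 ≤ Kx := by rw [hKx]; positivity
  have hKxC : 4 * 265 * Kx ≤ C₁ := by rw [hKx, hcLp, hκ₀, hr₀, hE₁, hD₀]; exact hC₁b
  have hstep : (cV + cL) * ((j : ℝ) + 1) * ρ ^ (j - 1)
      ≤ 265 * (2 * Real.sqrt 2 * C ^ 2) * ν ^ e + 265 * (2 * Kx) * y ^ e := by
    rw [hcVsplit]
    have hWf0 : 0 ≤ ((j : ℝ) + 1) * ρ ^ (j - 1) := by positivity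
    have h1 : 2 * Real.sqrt 2 * C ^ 2 * ν ^ σ * (((j : ℝ) + 1) * ρ ^ (j - 1)) ≤ 265 * (2 * Real.sqrt 2 * C ^ 2) * ν ^ e := by
      have := mul_le_mul (mul_le_mul_of_nonneg_left hνσ (by positivity : 0 ≤ 2 * Real.sqrt 2 * C ^ 2)) hW1
        hWf0 (by positivity)
      linarith
    have h2 : (2 * Real.sqrt 2 * C ^ 2 * g ^ σ + 2 * Real.sqrt 2 * C * r₀ * u + cL) * (((j : ℝ) + 1) * ρ ^ (j - 1))
        ≤ 265 * (2 * Kx) * y ^ e := by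
      have := mul_le_mul_of_nonneg_left hW2 (add_nonneg hcVr0 hcL0)
      refine this.trans ?_
      have := mul_le_mul_of_nonneg_left hcharge (by norm_num : (0:ℝ) ≤ 265)
      rw [hKx]
      linarith
    linarith
  -- `dW ≥ 1/2`, `min 1 y = y`
  have hRτ' : 1 ≤ 8 * Real.pi ^ 2 * loT lo Λ c ν n * Torus.freqNormSq ℓ * (t - s) := le_trans (by norm_num) hRτ
  have hdW : (1 / 2 : ℝ) ≤ dW lo Λ c ν n (t - s) ℓ := by
    have h := one_sub_exp_neg_ge (le_trans zero_le_one hRτ')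
    rw [min_eq_left hRτ'] at h
    unfold dW; linarith
  have hdW0 : 0 ≤ dW lo Λ c ν n (t - s) ℓ := le_trans (by norm_num) hdW
  have hy1 : y ≤ 1 := by linarith [hyu, hu1]
  have hy1' : M * W.period / ν / (t - s) ≤ 1 := hy1
  have hmin_y : min 1 (M * W.period / ν / (t - s)) = M * W.period / ν / (t - s) := min_eq_right hy1'
  have halw : 265 * (2 * Real.sqrt 2 * C ^ 2) * ν ^ e + 265 * (2 * Kx) * y ^ e
      ≤ (C₁ * (C₁ * (ν ^ e + ((⌈K / ν⌉₊ : ℝ) / n) ^ e) + (min 1 ((M * W.period / ν) / (t - s))) ^ e)) * dW lo Λ c ν n (t - s) ℓ := by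
    rw [hmin_y]
    have hue : 0 ≤ ((⌈K / ν⌉₊ : ℝ) / n) ^ e := Real.rpow_nonneg (by positivity) e
    have h1 : 265 * (2 * Real.sqrt 2 * C ^ 2) * ν ^ e ≤ (C₁ * C₁ / 2) * ν ^ e := mul_le_mul_of_nonneg_right (by linarith) hνe0
    have h2 : 265 * (2 * Kx) * y ^ e ≤ (C₁ / 2) * y ^ e := mul_le_mul_of_nonneg_right (by linarith) hye0
    have h3 : 0 ≤ C₁ * C₁ * ((⌈K / ν⌉₊ : ℝ) / n) ^ e := by positivity
    have h4 : (C₁ * C₁ / 2) * ν ^ e + (C₁ / 2) * y ^ e ≤ (C₁ * (C₁ * (ν ^ e + ((⌈K / ν⌉₊ : ℝ) / n) ^ e) + y ^ e)) * (1 / 2) := by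
      linarith
    have hA0 : 0 ≤ C₁ * (C₁ * (ν ^ e + ((⌈K / ν⌉₊ : ℝ) / n) ^ e) + y ^ e) :=
      mul_nonneg hC₁0 (add_nonneg (mul_nonneg hC₁0 (add_nonneg hνe0 hue)) hye0)
    have h5 : (C₁ * (C₁ * (ν ^ e + ((⌈K / ν⌉₊ : ℝ) / n) ^ e) + y ^ e)) * (1 / 2)
        ≤ (C₁ * (C₁ * (ν ^ e + ((⌈K / ν⌉₊ : ℝ) / n) ^ e) + y ^ e)) * dW lo Λ c ν n (t - s) ℓ :=
      mul_le_mul_of_nonneg_left hdW hA0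
    nlinarith [h1, h2, h4, h5]
  calc ‖fc (U s t v) ℓ‖ ≤ (cV + cL) * ((j : ℝ) + 1) * ρ ^ (j - 1) * ‖v‖ := hmain
    _ ≤ (265 * (2 * Real.sqrt 2 * C ^ 2) * ν ^ e + 265 * (2 * Kx) * y ^ e) * ‖v‖ := mul_le_mul_of_nonneg_right hstep hv0
    _ ≤ _ := mul_le_mul_of_nonneg_right halw hv0

end Clause

end Summit.AnomalousDissipation.AnomalousDissipation.Theorems.SolenoidalFractalHomogenisation.LagrangianStep.VmodGen

end
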